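import Literature.AlgebraicGeometry.Resolution.BlowupChartRegTransversal

/-!
# StellarCut T10a — «Guard»: the first-order DERIVATION GUARD of the «TameCut» round lemma
# (lens-6, g32 → g33 tool; 0-weight)

The hyp-shape round lemma of «TameCut» (`DeltaCutStellarTame`: residue `p ∤ n`) must bound the order of the controlled
transform `f' = F(e)` of `f = hⁿ + u·m` at EVERY point `y'` of the exceptional divisor — rational or not.  By the near-point
machinery already in the tree (`Literature…RegularCentreBlowupOrder`: the chart residue map `ρ : R[P/c_j] ↠ κ(y₀)[T_l : l ≠ j]`,
`ρ(F(e)) = F̄(T_j := 1)`, [CoP1] Prop. 4.2 (a)) the order of `f'` at `y'` is bounded by the order of the FIBRE POLYNOMIAL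
`g = F̄(T_j := 1) ∈ κ(y₀)[T]` at the prime `𝔮` of `y'`; for the hyp shape `F̄ = T_Hⁿ + c̄·Π_{l∈T∖H} T_l^{a_l}`, so
`g = 1 + c̄·Π T_l^{a_l}` on the `H`-chart and `g = T_Hⁿ + c̄·Π_{l≠j} T_l^{a_l}` on a `D_j`-chart.  This file proves the purely
algebraic GUARD that makes these orders `≤ 1 < n` off the strict transform `H'` when `p ∤ n`:

* `algebraMap_notMem_maximalIdeal_sq_of_derivation_apply_notMem` — **the guard**: if some derivation `D` has `D g ∉ 𝔮` then
  `g ∉ 𝔮² R_𝔮`, i.e. `ord_𝔮 g ≤ 1` (no hypothesis on the residue field of `𝔮` — this is what lets the round lemma treat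
  non-rational points); the case `p = 0, 𝔟 = ⊥, δ = 1, t = g + 1` of the tree's
  `Literature…BlowupChartRegTransversal.sub_pow_notMem_maximalIdeal_sq_sup_of_leibniz`, cited BY NAME;
* `pderiv_notMem_of_one_add_monomial_mem` — `H`-chart: for `g = 1 + c·T^d ∈ 𝔮` and an index `l` with `d l` invertible in `κ`,
  `∂g/∂T_l ∉ 𝔮` (at a birth `Σ_l d l = n` with `p ∤ n`, so such an `l` exists);
* `pderiv_notMem_of_X_pow_add_monomial` — `D_j`-chart: for `g = T_hⁿ + c·T^d` with `d h = 0`, `n` invertible in `κ` and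
  `T_h ∉ 𝔮` (the point is off `H'`), `∂g/∂T_h = n·T_h^{n-1} ∉ 𝔮`;
* `algebraMap_notMem_maximalIdeal_sq_of_notMem` (off `V(g)`), `algebraMap_one_add_monomial_notMem_sq`,
  `algebraMap_X_pow_add_monomial_notMem_sq` — the two order bounds `ord_𝔮 g ≤ 1`, in any localization `L` at `𝔮`.

The `¬ p ∣ n` hypothesis of TAME enters EXACTLY through `IsUnit (n : κ)` / `IsUnit (d l : κ)` (the deletion probe of the critic's
pre-ruling 222q (h3) is located here: in characteristic `p ∣ n`, `g = 1 + T²` over `𝔽₂` has `∂g = 0` and order `2` at `T = 1` —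
the kangaroo `x² + (1 + xz)·z²w²`).  PROVED over `Literature…BlowupChartRegTransversal` and Mathlib; [folklore]; stated for ANY
localization `L` at `𝔮` (`IsLocalization.AtPrime L 𝔮`), so that `L` may be a stalk.
-/

namespace Summit.ResolutionOfSingularities.ResolutionOfSingularities.Theorems.DeltaCutClasses

open IsLocalRing MvPolynomial
open Literature.AlgebraicGeometry.Resolution

section DerivationGuard

variable {S R : Type*} [CommRing S] [CommRing R] [Algebra S R]

/-- **The first-order derivation guard**: if a derivation `D` of `R` has `D g ∉ 𝔮` (`𝔮` prime), then the image of `g` in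
any localization `L` of `R` at `𝔮` does not lie in `𝔪_L²` — the order of `g` at `𝔮` is at most `1`.  No hypothesis on the
residue field `κ(𝔮)`.  This is `sub_pow_notMem_maximalIdeal_sq_sup_of_leibniz` (the Leibniz-operator lemma of
`BlowupChartRegTransversal`) with `p = 0`, `𝔟 = ⊥`, `δ = 1` applied to `t = g + 1`. [folklore] -/
theorem algebraMap_notMem_maximalIdeal_sq_of_derivation_apply_notMem (D : Derivation S R R) (𝔮 : Ideal R)
    [𝔮.IsPrime] (L : Type*) [CommRing L] [IsLocalRing L] [Algebra R L] [IsLocalization.AtPrime L 𝔮] {g : R}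
    (hD : D g ∉ 𝔮) : algebraMap R L g ∉ maximalIdeal L ^ 2 := by
  have h := sub_pow_notMem_maximalIdeal_sq_sup_of_leibniz 𝔮 L ⊥ bot_le 0 D.toLinearMap.toAddMonoidHom
    (fun x y => ?_) (fun x => ?_) (fun x hx => ?_) (t := g + 1) ?_ 1
  · rwa [Ideal.map_bot, sup_bot_eq, pow_zero, map_add, map_one, add_sub_cancel_right] at h
  · change D (x * y) = x * D y + y * D x
    rw [D.leibniz, smul_eq_mul, smul_eq_mul]
  · change D (x ^ 0) ∈ 𝔮
    rw [pow_zero, D.map_one_eq_zero]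
    exact 𝔮.zero_mem
  · change D x ∈ 𝔮
    rw [(Submodule.mem_bot _).mp hx, map_zero]
    exact 𝔮.zero_mem
  · change D (g + 1) ∉ 𝔮
    rwa [map_add, D.map_one_eq_zero, add_zero]

/-- Off `V(g)` there is nothing to guard: if `g ∉ 𝔮` then `g` is a unit of `L = R_𝔮`, in particular `g ∉ 𝔪_L²`. -/
theorem algebraMap_notMem_maximalIdeal_sq_of_notMem (𝔮 : Ideal R) [𝔮.IsPrime] (L : Type*) [CommRing L] [IsLocalRing L]
    [Algebra R L] [IsLocalization.AtPrime L 𝔮] {g : R} (hg : g ∉ 𝔮) : algebraMap R L g ∉ maximalIdeal L ^ 2 := fun hmem =>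
  hg ((IsLocalization.AtPrime.to_map_mem_maximal_iff L 𝔮 g).mp (Ideal.pow_le_self two_ne_zero hmem))

end DerivationGuard

section FibrePolynomialGuard

variable {κ : Type*} [CommRing κ] {σ : Type*}

/-- A prime ideal of `κ[T_σ]` witnesses that `κ` is non-trivial. -/
theorem nontrivial_of_isPrime_mvPolynomial (𝔮 : Ideal (MvPolynomial σ κ)) [𝔮.IsPrime] : Nontrivial κ := by
  by_contra h
  rw [not_nontrivial_iff_subsingleton] at h
  refine Ideal.IsPrime.ne_top ‹_› ((Ideal.eq_top_iff_one 𝔮).mpr ?_)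
  have h1 : (1 : MvPolynomial σ κ) = 0 := by
    rw [← C_1, Subsingleton.elim (1 : κ) 0, C_0]
  rw [h1]
  exact 𝔮.zero_mem

/-- **`H`-chart guard.**  For the fibre polynomial `g = 1 + c·T^d` of a hyp-shape birth, a prime `𝔮 ∋ g` and an index `l`
whose exponent `d l` is invertible in `κ`: `∂g/∂T_l = (d l)·c·T^{d - e_l} ∉ 𝔮` — multiplying by `T_l` would give
`(d l)·(g - 1) ∈ 𝔮`, hence `(d l) ∈ 𝔮`, a unit. [folklore] -/
theorem pderiv_notMem_of_one_add_monomial_mem (d : σ →₀ ℕ) (c : κ) (l : σ) (hl : IsUnit ((d l : ℕ) : κ))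
    (𝔮 : Ideal (MvPolynomial σ κ)) [𝔮.IsPrime] (hg : 1 + monomial d c ∈ 𝔮) :
    pderiv l (1 + monomial d c) ∉ 𝔮 := by
  classical
  haveI := nontrivial_of_isPrime_mvPolynomial 𝔮
  have hdl : d l ≠ 0 := by
    intro h
    rw [h, Nat.cast_zero] at hl
    exact not_isUnit_zero hl
  intro h
  have hX : X l * pderiv l (1 + monomial d c) ∈ 𝔮 := 𝔮.mul_mem_left _ h
  rw [map_add, pderiv_one, zero_add, pderiv_monomial, X, monomial_mul,
    add_tsub_cancel_of_le (Finsupp.single_le_iff.mpr (Nat.one_le_iff_ne_zero.mpr hdl))] at hX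
  -- `hX : monomial d (1 * (c * d l)) ∈ 𝔮`, i.e. `C (d l) * monomial d c ∈ 𝔮`
  have hX' : C ((d l : ℕ) : κ) * monomial d c ∈ 𝔮 := by
    rw [C_mul_monomial]
    convert hX using 2
    ring
  have hC : C ((d l : ℕ) : κ) ∈ 𝔮 := by
    have h3 := 𝔮.sub_mem (𝔮.mul_mem_left (C ((d l : ℕ) : κ)) hg) hX'
    rwa [mul_add, mul_one, add_sub_cancel_right] at h3
  exact Ideal.IsPrime.ne_top ‹_› (𝔮.eq_top_of_isUnit_mem hC (hl.map C))

/-- **`D_j`-chart guard.**  For the fibre polynomial `g = T_hⁿ + c·T^d` with `T_h` not occurring in `T^d` (`d h = 0`), `n`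
invertible in `κ` and a prime `𝔮 ∌ T_h` (a point of the exceptional divisor OFF the strict transform `H'`):
`∂g/∂T_h = n·T_h^{n-1} ∉ 𝔮`. [folklore] -/
theorem pderiv_notMem_of_X_pow_add_monomial {n : ℕ} (hn : IsUnit ((n : ℕ) : κ)) (h : σ) (d : σ →₀ ℕ) (hd : d h = 0)
    (c : κ) (𝔮 : Ideal (MvPolynomial σ κ)) [𝔮.IsPrime] (hh : X h ∉ 𝔮) :
    pderiv h (X h ^ n + monomial d c) ∉ 𝔮 := by
  classical
  haveI := nontrivial_of_isPrime_mvPolynomial 𝔮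
  intro hmem
  rw [map_add, pderiv_monomial, hd, Nat.cast_zero, mul_zero, map_zero, add_zero, pderiv_pow, pderiv_X_self,
    mul_one, ← map_natCast C] at hmem
  -- `hmem : C n * X h ^ (n - 1) ∈ 𝔮`
  rcases Ideal.IsPrime.mem_or_mem ‹_› hmem with hC | hXp
  · exact Ideal.IsPrime.ne_top ‹_› (𝔮.eq_top_of_isUnit_mem hC (hn.map C))
  · exact hh (Ideal.IsPrime.mem_of_pow_mem ‹_› _ hXp)

/-- **Order bound on the `H`-chart**: `ord_𝔮 (1 + c·T^d) ≤ 1` at every prime `𝔮` of `κ[T]`, as soon as one exponent `d l` is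
invertible in `κ` — at a point not on `V(g)` the polynomial is a unit, at a point of `V(g)` the guard applies. [folklore] -/
theorem algebraMap_one_add_monomial_notMem_sq (d : σ →₀ ℕ) (c : κ) (l : σ) (hl : IsUnit ((d l : ℕ) : κ))
    (𝔮 : Ideal (MvPolynomial σ κ)) [𝔮.IsPrime] (L : Type*) [CommRing L] [IsLocalRing L] [Algebra (MvPolynomial σ κ) L]
    [IsLocalization.AtPrime L 𝔮] : algebraMap (MvPolynomial σ κ) L (1 + monomial d c) ∉ maximalIdeal L ^ 2 := by
  by_cases hg : 1 + monomial d c ∈ 𝔮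
  · exact algebraMap_notMem_maximalIdeal_sq_of_derivation_apply_notMem (pderiv l) 𝔮 L
      (pderiv_notMem_of_one_add_monomial_mem d c l hl 𝔮 hg)
  · exact algebraMap_notMem_maximalIdeal_sq_of_notMem 𝔮 L hg

/-- **Order bound on a `D_j`-chart, off `H'`**: `ord_𝔮 (T_hⁿ + c·T^d) ≤ 1` at every prime `𝔮 ∌ T_h` of `κ[T]`, for `d h = 0`
and `n` invertible in `κ`. [folklore] -/
theorem algebraMap_X_pow_add_monomial_notMem_sq {n : ℕ} (hn : IsUnit ((n : ℕ) : κ)) (h : σ) (d : σ →₀ ℕ)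
    (hd : d h = 0) (c : κ) (𝔮 : Ideal (MvPolynomial σ κ)) [𝔮.IsPrime] (hh : X h ∉ 𝔮) (L : Type*) [CommRing L]
    [IsLocalRing L] [Algebra (MvPolynomial σ κ) L] [IsLocalization.AtPrime L 𝔮] :
    algebraMap (MvPolynomial σ κ) L (X h ^ n + monomial d c) ∉ maximalIdeal L ^ 2 :=
  algebraMap_notMem_maximalIdeal_sq_of_derivation_apply_notMem (pderiv h) 𝔮 L
    (pderiv_notMem_of_X_pow_add_monomial hn h d hd c 𝔮 hh)

end FibrePolynomialGuard

end Summit.ResolutionOfSingularities.ResolutionOfSingularities.Theorems.DeltaCutClasses
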